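import Summits.ValiantsHypothesis.ValiantsHypothesis.Theorems.GrenetZeonDualUnipotentThreeHalvesHeavyTopCodimOneCount

/-!
# `GrenetZeon.DualUnipotentThreeHalves` (stmt-ValiantsHypothesis-24318), R2 heavy-top instrument — COROLLARY II port, step (c1):
# the GRADED DIMENSION COUNT for ANY number of levels

General form of ✓ `…HeavyTopCodimOneCount.finrank_le_of_three_levels`: for a level function `lvl : Fin m → ℕ` with values `< L`, level sizes
`s t` with re-indexings `e t : {i // lvl i = t} ≃ Fin (s t)`, and a block upper-triangular `V ≤ M_m(ℂ)` (`A i j = 0` for `lvl i < lvl j`, the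
convention of ✓ `HeavyTopCompositionBlocks.exists_block_conj`) whose re-indexed diagonal blocks lie in `W t ≤ M_{s t}(ℂ)`,

`dim V ≤ Σ_t dim (W t) + #{(i, j) : lvl j < lvl i}`.

This is the form the classification needs to exclude TWO irreducible `3`-blocks (or any block of size `≥ 4`) in a composition chain of a space of
deficiency one, summing the block deficiencies of ✓ `…HeavyTopCodimOneBlocks` over all levels at once (crux note `CENSUS-THMC-UNIFORM-eng1g5.md` §8).

* ★ `finrank_le_of_levels` — the count (rank–nullity for `V → Π_t W t`, kernel injected into the functions on the strict pattern).

Honest framing: linear algebra; nothing here proves or refutes `HeavyTopLaw`, 24318, S3b or 8062; `VP ≠ VNP` is NOT proved.  No definitions.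
[folklore; cell val-heavytop-census, eng-1 g5]
-/

noncomputable section

-- single-conjunct layout: Sub = Summit, duplicated namespace component intended
set_option linter.dupNamespace false

namespace Summit.ValiantsHypothesis.ValiantsHypothesis.Theorems.GrenetZeon.HeavyTopCodimOneCount

open Matrix

/-- ★ **Graded count, any number of levels.**  `dim V ≤ Σ_t dim (W t) + #{(i, j) : lvl j < lvl i}`. [folklore] -/
theorem finrank_le_of_levels {m L : ℕ} (lvl : Fin m → ℕ) (hlvl : ∀ i, lvl i < L) (s : Fin L → ℕ)
    (e : ∀ t : Fin L, {i : Fin m // lvl i = (t : ℕ)} ≃ Fin (s t))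
    (V : Submodule ℂ (Matrix (Fin m) (Fin m) ℂ)) (hblock : ∀ A ∈ V, ∀ i j, lvl i < lvl j → A i j = 0)
    (W : ∀ t : Fin L, Submodule ℂ (Matrix (Fin (s t)) (Fin (s t)) ℂ))
    (hW : ∀ A ∈ V, ∀ t : Fin L,
      Matrix.reindex (e t) (e t) (A.toBlock (fun i => lvl i = (t : ℕ)) (fun i => lvl i = (t : ℕ))) ∈ W t) :
    Module.finrank ℂ V ≤ ∑ t, Module.finrank ℂ (W t) + Fintype.card {x : Fin m × Fin m // lvl x.2 < lvl x.1} := by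
  classical
  -- the diagonal-block map
  let D : V →ₗ[ℂ] (∀ t : Fin L, W t) :=
    { toFun := fun A t =>
        ⟨Matrix.reindex (e t) (e t) ((A : Matrix (Fin m) (Fin m) ℂ).toBlock (fun i => lvl i = (t : ℕ)) (fun i => lvl i = (t : ℕ))),
          hW A A.2 t⟩
      map_add' := fun A B => by
        funext t
        apply Subtype.ext
        ext a b
        rfl
      map_smul' := fun c A => by
        funext t
        apply Subtype.ext
        ext a b
        rfl }
  -- kernel members are supported on the strict pattern
  have hker : ∀ A : V, D A = 0 → ∀ i j, ¬ lvl j < lvl i → (A : Matrix (Fin m) (Fin m) ℂ) i j = 0 := by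
    intro A hA i j hij
    rcases lt_or_eq_of_le (not_lt.1 hij) with hlt | heq
    · exact hblock A A.2 i j hlt
    · have ht := congrArg (fun x => ((x ⟨lvl i, hlvl i⟩ : W ⟨lvl i, hlvl i⟩) : Matrix (Fin (s ⟨lvl i, hlvl i⟩)) (Fin (s ⟨lvl i, hlvl i⟩)) ℂ)) hA
      have hz : Matrix.reindex (e ⟨lvl i, hlvl i⟩) (e ⟨lvl i, hlvl i⟩)
          ((A : Matrix (Fin m) (Fin m) ℂ).toBlock (fun k => lvl k = lvl i) (fun k => lvl k = lvl i)) = 0 := ht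
      rw [← reindex_toBlock_apply lvl (e ⟨lvl i, hlvl i⟩) A i j rfl heq.symm, hz, Matrix.zero_apply]
  -- the kernel injects into the functions on the strict pattern
  let F : LinearMap.ker D →ₗ[ℂ] ({x : Fin m × Fin m // lvl x.2 < lvl x.1} → ℂ) :=
    { toFun := fun A x => ((A : V) : Matrix (Fin m) (Fin m) ℂ) x.1.1 x.1.2
      map_add' := fun A B => by funext x; rfl
      map_smul' := fun c A => by funext x; rfl }
  have hF : Function.Injective F := by
    intro A B hAB
    apply Subtype.ext
    apply Subtype.ext
    ext i j
    by_cases hij : lvl j < lvl i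
    · exact congrFun hAB ⟨(i, j), hij⟩
    · rw [hker A.1 (LinearMap.mem_ker.1 A.2) i j hij, hker B.1 (LinearMap.mem_ker.1 B.2) i j hij]
  have h1 := LinearMap.finrank_range_add_finrank_ker D
  have h2 : Module.finrank ℂ (LinearMap.range D) ≤ Module.finrank ℂ (∀ t : Fin L, W t) := Submodule.finrank_le _
  have h3 := LinearMap.finrank_le_finrank_of_injective hF
  rw [Module.finrank_fintype_fun_eq_card] at h3
  rw [Module.finrank_pi_fintype] at h2
  omega

end Summit.ValiantsHypothesis.ValiantsHypothesis.Theorems.GrenetZeon.HeavyTopCodimOneCount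

end
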